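import Mathlib
import Literature.NumberTheory.Sieve.BombieriFriedlanderIwaniecTheorem5Weights
import HarnessLib

/-!
# Elementary tools for dispersion estimates in boxes

Topic `Literature/NumberTheory/Sieve`.  Generic bookkeeping used when a bilinear form with a divisibility
condition `u ∣ A d m + B` is prepared for Linnik's dispersion method (Bombieri–Friedlander–Iwaniec 1986, §§3–6):

* splitting the variables into residue classes modulo `Q` (`sum_sum_ite_eq_sum_classes`), and parametrising a
  residue class `m ≡ c (mod Q)` of an interval by `m = c + Qy` (`sum_Ioc_ite_modEq_eq_sum_Ioc`);
* the dyadic decomposition of a variable according to `⌊log₂ d⌋` (`sum_eq_sum_range_natLog`);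
* square-root bookkeeping for the four terms of one dyadic scale (`sqrt_mul_sqrt_le_four_terms`);
* the smooth majorant `BFI.bump R (R/2)` of the dyadic block `[R, 2R]` and its integral;
* the absorption of the decay factor `exp(c₁ (1 + L)^{1/4} − c₂ √L)` into an arbitrary power of `1 + L`
  (`exp_quarter_sub_sqrt_le`).

## References
* E. Bombieri, J. B. Friedlander, H. Iwaniec, *Primes in arithmetic progressions to large moduli*,
  Acta Math. 156 (1986), §§3–6. [folklore bookkeeping]
-/

noncomputable section

open Finset Real MeasureTheory

namespace Literature.NumberTheory.Sieve

namespace DispersionBox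

/-! ### Residue classes -/

/-- Orthogonality of residue classes: for `0 < Q`, exactly one `c < Q` has `d ≡ c (mod Q)`, namely `d % Q`.
[folklore] -/
theorem sum_range_ite_modEq_eq {M : Type*} [AddCommMonoid M] {Q : ℕ} (hQ : 0 < Q) (d : ℤ)
    (h : ℕ → M) :
    ∑ c ∈ Finset.range Q, (if d ≡ (c : ℤ) [ZMOD Q] then h c else 0) = h (d % (Q : ℤ)).toNat := by
  have hQz : (0 : ℤ) < Q := by exact_mod_cast hQ
  have hmod0 : 0 ≤ d % (Q : ℤ) := Int.emod_nonneg _ hQz.ne'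
  have hmodQ : d % (Q : ℤ) < Q := Int.emod_lt_of_pos _ hQz
  have hcast : (((d % (Q : ℤ)).toNat : ℕ) : ℤ) = d % (Q : ℤ) := Int.toNat_of_nonneg hmod0
  rw [Finset.sum_eq_single (d % (Q : ℤ)).toNat]
  · rw [if_pos]
    rw [Int.ModEq, hcast, Int.emod_emod_of_dvd _ dvd_rfl]
  · intro c hc hne
    rw [if_neg]
    intro hmod
    apply hne
    rw [Int.ModEq] at hmod
    have hc : (c : ℤ) % Q = c := Int.emod_eq_of_lt (by positivity) (by
      have := Finset.mem_range.mp hc; exact_mod_cast this)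
    rw [hc] at hmod
    apply Int.ofNat_inj.mp
    rw [hcast, hmod]
  · intro hc
    exfalso
    apply hc
    rw [Finset.mem_range]
    have : (((d % (Q : ℤ)).toNat : ℕ) : ℤ) < Q := by rw [hcast]; exact hmodQ
    exact_mod_cast this

/-- Swapping the first two summations past the last two. [folklore] -/
theorem sum_comm_four {M : Type*} [AddCommMonoid M] {α β γ δ : Type*} (s₁ : Finset α) (s₂ : Finset β)
    (s₃ : Finset γ) (s₄ : Finset δ) (F : α → β → γ → δ → M) :
    ∑ a ∈ s₁, ∑ b ∈ s₂, ∑ c ∈ s₃, ∑ d ∈ s₄, F a b c d =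
      ∑ c ∈ s₃, ∑ d ∈ s₄, ∑ a ∈ s₁, ∑ b ∈ s₂, F a b c d := by
  calc ∑ a ∈ s₁, ∑ b ∈ s₂, ∑ c ∈ s₃, ∑ d ∈ s₄, F a b c d
      = ∑ a ∈ s₁, ∑ c ∈ s₃, ∑ b ∈ s₂, ∑ d ∈ s₄, F a b c d :=
        Finset.sum_congr rfl fun a _ => Finset.sum_comm
    _ = ∑ c ∈ s₃, ∑ a ∈ s₁, ∑ b ∈ s₂, ∑ d ∈ s₄, F a b c d := Finset.sum_comm
    _ = ∑ c ∈ s₃, ∑ a ∈ s₁, ∑ d ∈ s₄, ∑ b ∈ s₂, F a b c d :=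
        Finset.sum_congr rfl fun c _ => Finset.sum_congr rfl fun a _ => Finset.sum_comm
    _ = ∑ c ∈ s₃, ∑ d ∈ s₄, ∑ a ∈ s₁, ∑ b ∈ s₂, F a b c d :=
        Finset.sum_congr rfl fun c _ => Finset.sum_comm

/-- **Splitting into residue classes.**  If the predicate `Pr (d, m)` only depends on `(d mod Q, m mod Q)`, then
`∑_{d ∈ D} ∑_{m ∈ M} [Pr(d,m)] f(d,m) = ∑_{c_d, c_m mod Q} [Pr(c_d,c_m)] ∑_{d ≡ c_d} ∑_{m ≡ c_m} f(d,m)`. [folklore] -/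
theorem sum_sum_ite_eq_sum_classes {M : Type*} [AddCommMonoid M] {Q : ℕ} (hQ : 0 < Q)
    (D Ms : Finset ℕ) (Pr : ℤ → ℤ → Prop) [DecidableRel Pr]
    (hPr : ∀ d m d' m' : ℤ, d ≡ d' [ZMOD Q] → m ≡ m' [ZMOD Q] → (Pr d m ↔ Pr d' m'))
    (f : ℕ → ℕ → M) :
    ∑ d ∈ D, ∑ m ∈ Ms, (if Pr d m then f d m else 0) =
      ∑ cd ∈ Finset.range Q, ∑ cm ∈ Finset.range Q,
        (if Pr cd cm then
          ∑ d ∈ D.filter (fun d : ℕ => (d : ℤ) ≡ cd [ZMOD Q]),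
            ∑ m ∈ Ms, (if (m : ℤ) ≡ cm [ZMOD Q] then f d m else 0)
         else 0) := by
  -- push the outer indicator inside and unfold the filter
  have step1 : ∀ cd cm : ℕ,
      (if Pr cd cm then
          ∑ d ∈ D.filter (fun d : ℕ => (d : ℤ) ≡ cd [ZMOD Q]),
            ∑ m ∈ Ms, (if (m : ℤ) ≡ cm [ZMOD Q] then f d m else 0)
        else 0) =
      ∑ d ∈ D, ∑ m ∈ Ms, (if (d : ℤ) ≡ cd [ZMOD Q] then
        (if (m : ℤ) ≡ cm [ZMOD Q] then (if Pr cd cm then f d m else 0) else 0) else 0) := by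
    intro cd cm
    by_cases h : Pr cd cm
    · simp only [if_pos h]
      rw [Finset.sum_filter]
      refine Finset.sum_congr rfl fun d _ => ?_
      by_cases hd : (d : ℤ) ≡ cd [ZMOD Q]
      · simp only [if_pos hd]
      · simp only [if_neg hd, Finset.sum_const_zero]
    · simp only [if_neg h, ite_self, Finset.sum_const_zero]
  simp_rw [step1]
  rw [sum_comm_four]
  refine Finset.sum_congr rfl fun d _ => ?_
  refine Finset.sum_congr rfl fun m _ => ?_
  -- now: ∑ cd, ∑ cm, [d ≡ cd][m ≡ cm][Pr cd cm] f d m = [Pr d m] f d m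
  have inner : ∀ cd : ℕ, ∑ cm ∈ Finset.range Q,
      (if (d : ℤ) ≡ cd [ZMOD Q] then
        (if (m : ℤ) ≡ cm [ZMOD Q] then (if Pr cd cm then f d m else 0) else 0) else 0) =
      (if (d : ℤ) ≡ cd [ZMOD Q] then (if Pr cd (((m : ℤ) % (Q : ℤ)).toNat : ℕ) then f d m else 0)
        else 0) := by
    intro cd
    by_cases hd : (d : ℤ) ≡ cd [ZMOD Q]
    · simp only [if_pos hd]
      exact sum_range_ite_modEq_eq hQ (m : ℤ) (fun cm => if Pr cd cm then f d m else 0)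
    · simp only [if_neg hd]
      exact Finset.sum_const_zero
  simp_rw [inner]
  rw [sum_range_ite_modEq_eq hQ (d : ℤ) (fun cd => if Pr cd (((m : ℤ) % (Q : ℤ)).toNat : ℕ) then f d m else 0)]
  have hQz : (0 : ℤ) < Q := by exact_mod_cast hQ
  have h1 : ((((d : ℤ) % (Q : ℤ)).toNat : ℕ) : ℤ) ≡ d [ZMOD Q] := by
    rw [Int.toNat_of_nonneg (Int.emod_nonneg _ hQz.ne'), Int.ModEq, Int.emod_emod_of_dvd _ dvd_rfl]
  have h2 : ((((m : ℤ) % (Q : ℤ)).toNat : ℕ) : ℤ) ≡ m [ZMOD Q] := by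
    rw [Int.toNat_of_nonneg (Int.emod_nonneg _ hQz.ne'), Int.ModEq, Int.emod_emod_of_dvd _ dvd_rfl]
  simp only [hPr _ _ _ _ h1 h2]

/-- **Parametrising a residue class of an interval.**  For `0 < Q`, the `m ∈ (M_b, M_b']` with `m ≡ c (mod Q)` are
exactly the `m = c + Qy` with `⌊(M_b − c)/Q⌋ < y ≤ ⌊(M_b' − c)/Q⌋`. [folklore] -/
theorem sum_Ioc_ite_modEq_eq_sum_Ioc {M : Type*} [AddCommMonoid M] {Q : ℕ} (hQ : 0 < Q) (c : ℤ)
    (Mb Mb' : ℕ) (g : ℤ → M) :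
    ∑ m ∈ Finset.Ioc Mb Mb', (if (m : ℤ) ≡ c [ZMOD Q] then g m else 0) =
      ∑ y ∈ Finset.Ioc (((Mb : ℤ) - c) / (Q : ℤ)) (((Mb' : ℤ) - c) / (Q : ℤ)), g (c + Q * y) := by
  rw [← Finset.sum_filter]
  have hQz : (0 : ℤ) < Q := by exact_mod_cast hQ
  refine Finset.sum_nbij' (fun m : ℕ => ((m : ℤ) - c) / (Q : ℤ)) (fun y : ℤ => (c + Q * y).toNat)
    ?_ ?_ ?_ ?_ ?_
  · intro m hm
    rw [Finset.mem_filter, Finset.mem_Ioc] at hm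
    obtain ⟨⟨h1, h2⟩, h3⟩ := hm
    obtain ⟨k, hk⟩ := h3.symm.dvd
    have hk' : ((m : ℤ) - c) / (Q : ℤ) = k := by
      rw [hk, Int.mul_ediv_cancel_left _ hQz.ne']
    rw [Finset.mem_Ioc, hk', Int.ediv_lt_iff_lt_mul hQz, Int.le_ediv_iff_mul_le hQz]
    have h1' : (Mb : ℤ) < m := by exact_mod_cast h1
    have h2' : (m : ℤ) ≤ Mb' := by exact_mod_cast h2
    constructor <;> linarith [hk]
  · intro y hy
    rw [Finset.mem_Ioc, Int.ediv_lt_iff_lt_mul hQz, Int.le_ediv_iff_mul_le hQz] at hy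
    have hpos : 0 ≤ c + Q * y := by
      have : (0 : ℤ) ≤ Mb := by positivity
      linarith [hy.1]
    have hcast : ((c + Q * y).toNat : ℤ) = c + Q * y := Int.toNat_of_nonneg hpos
    rw [Finset.mem_filter, Finset.mem_Ioc]
    refine ⟨⟨?_, ?_⟩, ?_⟩
    · have : (Mb : ℤ) < ((c + Q * y).toNat : ℤ) := by rw [hcast]; linarith [hy.1]
      exact_mod_cast this
    · have : ((c + Q * y).toNat : ℤ) ≤ Mb' := by rw [hcast]; linarith [hy.2]
      exact_mod_cast this
    · rw [hcast, Int.ModEq, Int.add_mul_emod_self_left]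
  · intro m hm
    rw [Finset.mem_filter] at hm
    obtain ⟨k, hk⟩ := hm.2.symm.dvd
    rw [hk, Int.mul_ediv_cancel_left _ hQz.ne', ← hk, add_sub_cancel, Int.toNat_natCast]
  · intro y hy
    rw [Finset.mem_Ioc, Int.ediv_lt_iff_lt_mul hQz, Int.le_ediv_iff_mul_le hQz] at hy
    have hpos : 0 ≤ c + Q * y := by
      have : (0 : ℤ) ≤ Mb := by positivity
      linarith [hy.1]
    rw [Int.toNat_of_nonneg hpos, add_sub_cancel_left, Int.mul_ediv_cancel_left _ hQz.ne']
  · intro m hm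
    rw [Finset.mem_filter] at hm
    obtain ⟨k, hk⟩ := hm.2.symm.dvd
    rw [hk, Int.mul_ediv_cancel_left _ hQz.ne', ← hk, add_sub_cancel]

/-- Membership in the parametrised class: `⌊(M_b − c)/Q⌋ < y ≤ ⌊(M_b' − c)/Q⌋` gives `M_b < c + Qy ≤ M_b'`.
[folklore] -/
theorem lt_and_le_of_mem_Ioc_ediv {Q : ℕ} (hQ : 0 < Q) {c : ℤ} {Mb Mb' : ℕ} {y : ℤ}
    (hy : y ∈ Finset.Ioc (((Mb : ℤ) - c) / (Q : ℤ)) (((Mb' : ℤ) - c) / (Q : ℤ))) :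
    (Mb : ℤ) < c + Q * y ∧ c + Q * y ≤ Mb' := by
  have hQz : (0 : ℤ) < Q := by exact_mod_cast hQ
  rw [Finset.mem_Ioc, Int.ediv_lt_iff_lt_mul hQz, Int.le_ediv_iff_mul_le hQz] at hy
  constructor <;> linarith [hy.1, hy.2]

/-- Length of the parametrising range: `⌊(M_b' − c)/Q⌋ − ⌊(M_b − c)/Q⌋ ≤ (M_b' − M_b)/Q + 1` (as reals), for
`M_b ≤ M_b'`. [folklore] -/
theorem cast_ediv_sub_ediv_le {Q : ℕ} (hQ : 0 < Q) (c : ℤ) {Mb Mb' : ℕ} (_h : Mb ≤ Mb') :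
    ((((Mb' : ℤ) - c) / (Q : ℤ) - ((Mb : ℤ) - c) / (Q : ℤ) : ℤ) : ℝ) ≤ ((Mb' : ℝ) - Mb) / Q + 1 := by
  have hQz : (0 : ℤ) < Q := by exact_mod_cast hQ
  have hQr : (0 : ℝ) < Q := by exact_mod_cast hQ
  have h1 : ((Mb' : ℤ) - c) / (Q : ℤ) * Q ≤ (Mb' : ℤ) - c := Int.ediv_mul_le _ hQz.ne'
  have h2 : (Mb : ℤ) - c < (((Mb : ℤ) - c) / (Q : ℤ) + 1) * Q := Int.lt_ediv_add_one_mul_self _ hQz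
  have h1r : ((((Mb' : ℤ) - c) / (Q : ℤ) : ℤ) : ℝ) * Q ≤ (Mb' : ℝ) - c := by exact_mod_cast h1
  have h2r : (Mb : ℝ) - c < (((((Mb : ℤ) - c) / (Q : ℤ) : ℤ) : ℝ) + 1) * Q := by exact_mod_cast h2
  rw [div_add_one hQr.ne', le_div_iff₀ hQr]
  push_cast
  nlinarith

/-! ### Dyadic decomposition -/

/-- Dyadic decomposition according to `k = ⌊log₂ d⌋`: a sum over `D ⊆ [0, X]` is the sum over `k ≤ ⌊log₂ X⌋` of the
sums over `D ∩ {⌊log₂ d⌋ = k}`. [folklore] -/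
theorem sum_eq_sum_range_natLog {M : Type*} [AddCommMonoid M] (D : Finset ℕ) {X : ℕ}
    (hD : ∀ d ∈ D, d ≤ X) (f : ℕ → M) :
    ∑ d ∈ D, f d =
      ∑ k ∈ Finset.range (Nat.log 2 X + 1), ∑ d ∈ D.filter (fun d => Nat.log 2 d = k), f d := by
  rw [Finset.sum_fiberwise_of_maps_to]
  intro d hd
  exact Finset.mem_range.mpr (Nat.lt_succ_of_le (Nat.log_mono_right (hD d hd)))

/-- Elements of the `k`-th dyadic piece satisfy `2^k ≤ d < 2^{k+1}` (for `d ≠ 0`). [folklore] -/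
theorem pow_le_and_lt_of_natLog_eq {d k : ℕ} (hd : d ≠ 0) (hk : Nat.log 2 d = k) :
    2 ^ k ≤ d ∧ d < 2 ^ (k + 1) := by
  subst hk
  exact ⟨Nat.pow_log_le_self 2 hd, Nat.lt_pow_succ_log_self (by norm_num) d⟩

/-- The number of dyadic scales below `X ≤ x²` is at most `3 (1 + log x)`. [folklore] -/
theorem natLog_two_add_one_le {X : ℕ} {x : ℝ} (hX : X ≠ 0) (hx : 1 ≤ x) (hXx : (X : ℝ) ≤ x ^ (2 : ℝ)) :
    ((Nat.log 2 X : ℕ) : ℝ) + 1 ≤ 3 * (1 + Real.log x) := by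
  have h1 : (2 : ℝ) ^ (Nat.log 2 X) ≤ X := by exact_mod_cast Nat.pow_log_le_self 2 hX
  have hx0 : 0 < x := by linarith
  have h2 : (Nat.log 2 X : ℝ) * Real.log 2 ≤ 2 * Real.log x := by
    have := Real.log_le_log (by positivity) (h1.trans hXx)
    rwa [Real.log_pow, Real.log_rpow hx0] at this
  have hlog2 : (2 / 3 : ℝ) < Real.log 2 := by
    have := Real.log_two_gt_d9; linarith
  have hlx : 0 ≤ Real.log x := Real.log_nonneg hx
  have hn0 : (0 : ℝ) ≤ (Nat.log 2 X : ℕ) := Nat.cast_nonneg _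
  have h3 : ((Nat.log 2 X : ℕ) : ℝ) * (2 / 3) ≤ (Nat.log 2 X : ℕ) * Real.log 2 :=
    mul_le_mul_of_nonneg_left hlog2.le hn0
  linarith

/-! ### Square roots -/

/-- `√(a + b + c + d) ≤ √a + √b + √c + √d` for nonnegative reals. [folklore] -/
theorem sqrt_add_four_le {a b c d : ℝ} (ha : 0 ≤ a) (hb : 0 ≤ b) (hc : 0 ≤ c) (hd : 0 ≤ d) :
    Real.sqrt (a + b + c + d) ≤ Real.sqrt a + Real.sqrt b + Real.sqrt c + Real.sqrt d := by
  have two : ∀ u v : ℝ, 0 ≤ u → 0 ≤ v → Real.sqrt (u + v) ≤ Real.sqrt u + Real.sqrt v := by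
    intro u v hu hv
    rw [Real.sqrt_le_left (by positivity)]
    nlinarith [Real.sq_sqrt hu, Real.sq_sqrt hv, Real.sqrt_nonneg u, Real.sqrt_nonneg v]
  calc Real.sqrt (a + b + c + d) ≤ Real.sqrt (a + b + c) + Real.sqrt d := two _ _ (by positivity) hd
    _ ≤ Real.sqrt (a + b) + Real.sqrt c + Real.sqrt d := by
        have := two (a + b) c (by positivity) hc; linarith
    _ ≤ Real.sqrt a + Real.sqrt b + Real.sqrt c + Real.sqrt d := by
        have := two a b ha hb; linarith

/-! ### The smooth majorant of a dyadic block -/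

/-- `∫ bump M Y ≤ M + 2Y`. [folklore] -/
theorem integral_bump_le {M Y : ℝ} (hY : 0 < Y) (hM : 0 ≤ M) : ∫ t, BFI.bump M Y t ≤ M + 2 * Y := by
  have h := BFI.integral_norm_bumpC_le hY hM
  have hfun : (fun t => ‖BFI.bumpC M Y t‖) = BFI.bump M Y := by
    funext t
    rw [BFI.bumpC_apply, Complex.norm_real, Real.norm_of_nonneg (BFI.bump_mem_Icc hY hM t).1]
  rw [hfun] at h
  exact h

/-- The weight `F = bump R (R/2)` (for `R > 0`): smooth, supported in `[R/2, 4R]`, `0 ≤ F ≤ 1`, `|F''| ≤ 8K₂/R²`,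
`F = 1` on `[R, 2R]`, `∫ F ≤ 2R`. [folklore] -/
theorem bump_dispersion_hyps {R : ℝ} (hR : 0 < R) :
    ContDiff ℝ ((⊤ : ℕ∞) : WithTop ℕ∞) (BFI.bump R (R / 2)) ∧
    (∀ x, BFI.bump R (R / 2) x ≠ 0 → R / 2 ≤ x ∧ x ≤ 4 * R) ∧
    (∀ x, 0 ≤ BFI.bump R (R / 2) x) ∧
    (∀ x, ‖BFI.bump R (R / 2) x‖ ≤ 1) ∧
    (∀ x, ‖iteratedDeriv 2 (BFI.bump R (R / 2)) x‖ ≤ 8 * BFI.derivConst 2 / R ^ 2) ∧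
    (∀ x, R ≤ x → x ≤ 2 * R → BFI.bump R (R / 2) x = 1) ∧
    ∫ x, BFI.bump R (R / 2) x ≤ 2 * R := by
  have hY : 0 < R / 2 := by positivity
  refine ⟨BFI.contDiff_bump R (R / 2), ?_, fun x => (BFI.bump_mem_Icc hY hR.le x).1, ?_, ?_, ?_, ?_⟩
  · intro x hx
    constructor
    · by_contra h
      exact hx (BFI.bump_eq_zero_of_le hY hR.le (by linarith))
    · by_contra h
      exact hx (BFI.bump_eq_zero_of_ge hY hR.le (by linarith))
  · intro x
    rw [Real.norm_eq_abs]
    exact BFI.abs_bump_le_one hY hR.le x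
  · intro x
    refine (BFI.norm_iteratedDeriv_bump_le (by norm_num) hY x).trans (le_of_eq ?_)
    field_simp
    ring
  · intro x h1 h2
    exact BFI.bump_eq_one hY h1 h2
  · exact (integral_bump_le hY hR.le).trans (by linarith)

/-! ### Absorbing the decay factor into powers of the logarithm -/

/-- **Decay absorption.**  For `c₂ > 0` and any `C₀, c₁, N`:
`C₀ · exp(c₁ (1 + L)^{1/4} − c₂ √L) ≤ (1 + L)^{−N}` for all large `L`. [folklore] -/
theorem exp_quarter_sub_sqrt_le (C₀ c₁ N : ℝ) {c₂ : ℝ} (hc₂ : 0 < c₂) :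
    ∃ L₁ : ℝ, 1 ≤ L₁ ∧ ∀ L : ℝ, L₁ ≤ L →
      C₀ * Real.exp (c₁ * (1 + L) ^ (1 / 4 : ℝ) - c₂ * Real.sqrt L) ≤ (1 + L) ^ (-N) := by
  set Mc : ℝ := |Real.log C₀| + 2 * |c₁| + 8 * |N| with hMc
  have hMc0 : 0 ≤ Mc := by positivity
  refine ⟨max 1 ((Mc / c₂) ^ 4 + 1), le_max_left _ _, fun L hL => ?_⟩
  have hL1 : 1 ≤ L := le_trans (le_max_left _ _) hL
  have hL4 : (Mc / c₂) ^ 4 < L := by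
    have := le_trans (le_max_right _ _) hL; linarith
  have hL0 : 0 < L := by linarith
  have h1L : 0 < 1 + L := by linarith
  rcases le_or_gt C₀ 0 with hC | hC
  · exact le_trans (mul_nonpos_of_nonpos_of_nonneg hC (Real.exp_pos _).le)
      (Real.rpow_nonneg h1L.le _)
  -- `C₀ > 0`: compare exponents
  set r : ℝ := Real.sqrt (Real.sqrt L) with hr
  have hr0 : 0 ≤ r := Real.sqrt_nonneg _
  have hr2 : r ^ 2 = Real.sqrt L := by rw [hr, Real.sq_sqrt (Real.sqrt_nonneg _)]
  have hr4 : r ^ 4 = L := by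
    rw [show (4 : ℕ) = 2 * 2 from rfl, pow_mul, hr2, Real.sq_sqrt hL0.le]
  have hr1 : 1 ≤ r := by
    have h1 : 1 ≤ Real.sqrt L := by simpa using Real.sqrt_le_sqrt hL1
    simpa [hr] using Real.sqrt_le_sqrt h1
  -- `r > Mc / c₂`
  have hrM : Mc / c₂ < r := by
    have h0 : 0 ≤ Mc / c₂ := by positivity
    exact lt_of_pow_lt_pow_left₀ 4 hr0 (by rw [hr4]; exact hL4)
  have hrM' : Mc ≤ c₂ * r := by
    rw [div_lt_iff₀ hc₂] at hrM; linarith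
  -- `(1 + L)^{1/4} ≤ 2r`
  have hquarter : (1 + L) ^ (1 / 4 : ℝ) ≤ 2 * r := by
    have h16 : 1 + L ≤ (2 * r) ^ 4 := by
      rw [mul_pow, hr4]; norm_num; linarith
    have := Real.rpow_le_rpow h1L.le h16 (by norm_num : (0 : ℝ) ≤ 1 / 4)
    refine this.trans (le_of_eq ?_)
    rw [show (1 / 4 : ℝ) = ((4 : ℕ) : ℝ)⁻¹ by norm_num]
    exact Real.pow_rpow_inv_natCast (by positivity) (by norm_num)
  have hq0 : 0 ≤ (1 + L) ^ (1 / 4 : ℝ) := Real.rpow_nonneg h1L.le _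
  -- `log (1 + L) ≤ 8 r`
  have hlog : Real.log (1 + L) ≤ 8 * r := by
    have := Real.log_le_rpow_div h1L.le (by norm_num : (0 : ℝ) < 1 / 4)
    rw [div_eq_mul_inv, show ((1 / 4 : ℝ))⁻¹ = 4 by norm_num] at this
    linarith
  have hlog0 : 0 ≤ Real.log (1 + L) := Real.log_nonneg (by linarith)
  -- the exponent inequality
  have key : Real.log C₀ + (c₁ * (1 + L) ^ (1 / 4 : ℝ) - c₂ * Real.sqrt L) ≤ -N * Real.log (1 + L) := by
    have e1 : Real.log C₀ ≤ |Real.log C₀| * r := by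
      calc Real.log C₀ ≤ |Real.log C₀| := le_abs_self _
        _ = |Real.log C₀| * 1 := (mul_one _).symm
        _ ≤ |Real.log C₀| * r := mul_le_mul_of_nonneg_left hr1 (abs_nonneg _)
    have e2 : c₁ * (1 + L) ^ (1 / 4 : ℝ) ≤ 2 * |c₁| * r := by
      calc c₁ * (1 + L) ^ (1 / 4 : ℝ) ≤ |c₁| * (1 + L) ^ (1 / 4 : ℝ) :=
            mul_le_mul_of_nonneg_right (le_abs_self _) hq0
        _ ≤ |c₁| * (2 * r) := mul_le_mul_of_nonneg_left hquarter (abs_nonneg _)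
        _ = 2 * |c₁| * r := by ring
    have e3 : -N * Real.log (1 + L) ≥ -(8 * |N| * r) := by
      have : N * Real.log (1 + L) ≤ |N| * Real.log (1 + L) :=
        mul_le_mul_of_nonneg_right (le_abs_self _) hlog0
      have : |N| * Real.log (1 + L) ≤ |N| * (8 * r) := mul_le_mul_of_nonneg_left hlog (abs_nonneg _)
      nlinarith
    have e4 : c₂ * Real.sqrt L = c₂ * r ^ 2 := by rw [hr2]
    have e5 : Mc * r ≤ c₂ * r ^ 2 := by nlinarith
    rw [e4]
    have : |Real.log C₀| * r + 2 * |c₁| * r + 8 * |N| * r = Mc * r := by rw [hMc]; ring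
    linarith
  calc C₀ * Real.exp (c₁ * (1 + L) ^ (1 / 4 : ℝ) - c₂ * Real.sqrt L)
      = Real.exp (Real.log C₀ + (c₁ * (1 + L) ^ (1 / 4 : ℝ) - c₂ * Real.sqrt L)) := by
        rw [Real.exp_add, Real.exp_log hC]
    _ ≤ Real.exp (-N * Real.log (1 + L)) := Real.exp_le_exp.mpr key
    _ = (1 + L) ^ (-N) := by
        rw [Real.rpow_def_of_pos h1L]; ring_nf

/-- Variant with a linear decay `exp(−c₂ L)` (weaker than `exp(−c₂ √L)` for `L ≥ 1`). [folklore] -/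
theorem exp_quarter_sub_lin_le (C₀ c₁ N : ℝ) {c₂ : ℝ} (hc₂ : 0 < c₂) (hC₀ : 0 ≤ C₀) :
    ∃ L₁ : ℝ, 1 ≤ L₁ ∧ ∀ L : ℝ, L₁ ≤ L →
      C₀ * Real.exp (c₁ * (1 + L) ^ (1 / 4 : ℝ) - c₂ * L) ≤ (1 + L) ^ (-N) := by
  obtain ⟨L₁, hL₁, h⟩ := exp_quarter_sub_sqrt_le C₀ c₁ N hc₂
  refine ⟨L₁, hL₁, fun L hL => le_trans ?_ (h L hL)⟩
  have hL1 : 1 ≤ L := hL₁.trans hL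
  refine mul_le_mul_of_nonneg_left (Real.exp_le_exp.mpr ?_) hC₀
  have hs : Real.sqrt L ≤ L := by
    rw [Real.sqrt_le_left (by linarith)]
    nlinarith
  have := mul_le_mul_of_nonneg_left hs hc₂.le
  linarith

/-- Powers of `1 + L` are eventually below `exp(ε L)`: `C₀ (1 + L)^N ≤ exp(ε L)` for large `L`. [folklore] -/
theorem mul_one_add_rpow_le_exp (C₀ N : ℝ) {ε : ℝ} (hε : 0 < ε) (hC₀ : 0 ≤ C₀) :
    ∃ L₁ : ℝ, 1 ≤ L₁ ∧ ∀ L : ℝ, L₁ ≤ L → C₀ * (1 + L) ^ N ≤ Real.exp (ε * L) := by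
  obtain ⟨L₁, hL₁, h⟩ := exp_quarter_sub_lin_le C₀ 0 N hε hC₀
  refine ⟨L₁, hL₁, fun L hL => ?_⟩
  have hL1 : 1 ≤ L := hL₁.trans hL
  have h1L : 0 < 1 + L := by linarith
  have hE : 0 < Real.exp (ε * L) := Real.exp_pos _
  have hP : 0 < (1 + L) ^ N := Real.rpow_pos_of_pos h1L _
  have := h L hL
  rw [zero_mul, zero_sub, Real.exp_neg, mul_inv_le_iff₀ hE, Real.rpow_neg h1L.le] at this
  calc C₀ * (1 + L) ^ N ≤ ((1 + L) ^ N)⁻¹ * Real.exp (ε * L) * (1 + L) ^ N :=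
        mul_le_mul_of_nonneg_right this hP.le
    _ = Real.exp (ε * L) := by field_simp


/-! ### Cast and weight bookkeeping for the dispersion engine -/


/-- **Real form of the dispersion.**  With real coefficients `a_u`, the dispersion `𝒟 − MT` of the linear divisor
problem (written over `ℂ`) is the complexification of the corresponding real expression, so its norm is an
absolute value. [folklore] -/
theorem norm_dispersion_ofReal (U : Finset ℕ) (a : ℕ → ℝ) (F : ℝ → ℝ) (Q : ℕ) (cd cm A B : ℤ) (R : ℝ)
    (y₁ y₂ : ℤ) :
    ‖(∑ d ∈ (Finset.range (⌊4 * R⌋₊ + 1)).filter (fun d : ℕ => (d : ℤ) ≡ cd [ZMOD Q]),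
          ((F d : ℝ) : ℂ) *
            (‖∑ u ∈ U, ((a u : ℝ) : ℂ) * ∑ y ∈ Finset.Ioc y₁ y₂,
                (if (u : ℤ) ∣ A * d * (cm + Q * y) + B then (1 : ℂ) else 0)‖ : ℂ) ^ 2)
        - ((∫ x, F x : ℝ) : ℂ) / (Q : ℂ) *
          ∑ u ∈ U, ∑ u' ∈ U, ((a u : ℝ) : ℂ) * (starRingEnd ℂ) ((a u' : ℝ) : ℂ) *
            ((((Finset.Ioc y₁ y₂) ×ˢ (Finset.Ioc y₁ y₂)).filter (fun p : ℤ × ℤ =>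
                Int.gcd (cm + Q * p.1) u = 1 ∧ Int.gcd (cm + Q * p.2) u' = 1 ∧
                cm + Q * p.1 ≡ cm + Q * p.2 [ZMOD (Nat.gcd u u' : ℕ)])).card : ℂ) /
            ((Nat.lcm u u' : ℕ) : ℂ)‖ =
    |(∑ d ∈ (Finset.range (⌊4 * R⌋₊ + 1)).filter (fun d : ℕ => (d : ℤ) ≡ cd [ZMOD Q]),
          F d * (∑ u ∈ U, a u * ∑ y ∈ Finset.Ioc y₁ y₂,
                (if (u : ℤ) ∣ A * d * (cm + Q * y) + B then (1 : ℝ) else 0)) ^ 2)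
        - (∫ x, F x) / (Q : ℝ) *
          ∑ u ∈ U, ∑ u' ∈ U, a u * a u' *
            ((((Finset.Ioc y₁ y₂) ×ˢ (Finset.Ioc y₁ y₂)).filter (fun p : ℤ × ℤ =>
                Int.gcd (cm + Q * p.1) u = 1 ∧ Int.gcd (cm + Q * p.2) u' = 1 ∧
                cm + Q * p.1 ≡ cm + Q * p.2 [ZMOD (Nat.gcd u u' : ℕ)])).card : ℝ) /
            ((Nat.lcm u u' : ℕ) : ℝ)| := by
  have h1 : ∀ d : ℕ, (∑ u ∈ U, ((a u : ℝ) : ℂ) * ∑ y ∈ Finset.Ioc y₁ y₂,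
      (if (u : ℤ) ∣ A * d * (cm + Q * y) + B then (1 : ℂ) else 0)) =
      ((∑ u ∈ U, a u * ∑ y ∈ Finset.Ioc y₁ y₂,
        (if (u : ℤ) ∣ A * d * (cm + Q * y) + B then (1 : ℝ) else 0) : ℝ) : ℂ) := by
    intro d
    push_cast
    refine Finset.sum_congr rfl fun u _ => ?_
    congr 1
    refine Finset.sum_congr rfl fun y _ => ?_
    split_ifs <;> simp
  simp_rw [h1, Complex.norm_real, Real.norm_eq_abs, Complex.conj_ofReal]
  conv_rhs => rw [← Real.norm_eq_abs, ← Complex.norm_real]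
  congr 1
  push_cast
  congr 1
  refine Finset.sum_congr rfl fun d _ => ?_
  congr 1
  rw [← Complex.ofReal_pow, sq_abs, Complex.ofReal_pow, ← h1 d]
  congr 1
  refine Finset.sum_congr rfl fun u _ => ?_
  congr 1
  refine Finset.sum_congr rfl fun y _ => ?_
  split_ifs <;> simp

/-- The normalised weights `μ(tu) log(tu)/L`, `L = 1 + log(tU₂)`, are bounded by `1` for `u ≤ U₂`. [folklore] -/
theorem abs_moebius_mul_log_div_le_one {t U₂ u : ℕ} (ht : 0 < t) (hu : u ≤ U₂) {L : ℝ}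
    (hL : 1 + Real.log ((t : ℝ) * U₂) ≤ L) :
    |(ArithmeticFunction.moebius (t * u) : ℝ) * Real.log ((t : ℝ) * u) / L| ≤ 1 := by
  have hlog0 : 0 ≤ Real.log ((t : ℝ) * U₂) := by
    rw [← Nat.cast_mul]; exact Real.log_natCast_nonneg _
  have hL1 : 1 ≤ L := by linarith
  have hL0 : 0 < L := by linarith
  rcases Nat.eq_zero_or_pos u with rfl | hu0
  · simp
  have hlog : Real.log ((t : ℝ) * u) ≤ Real.log ((t : ℝ) * U₂) := by
    apply Real.log_le_log (by positivity)
    exact_mod_cast Nat.mul_le_mul_left t hu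
  have hlogu0 : 0 ≤ Real.log ((t : ℝ) * u) := by
    rw [← Nat.cast_mul]; exact Real.log_natCast_nonneg _
  have hμ : |(ArithmeticFunction.moebius (t * u) : ℝ)| ≤ 1 := by
    exact_mod_cast ArithmeticFunction.abs_moebius_le_one
  rw [abs_div, abs_mul, abs_of_pos hL0, div_le_one hL0, abs_of_nonneg hlogu0]
  calc |(ArithmeticFunction.moebius (t * u) : ℝ)| * Real.log ((t : ℝ) * u)
      ≤ 1 * Real.log ((t : ℝ) * u) := mul_le_mul_of_nonneg_right hμ hlogu0
    _ ≤ L := by linarith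


/-! ### The decay factor -/


/-- **The decay factor of the Möbius main term is eventually below any power of the logarithm.**  With
`B = exp(48 (L+1)^{1/4})` (the bound for the coprimality factors at moduli `≤ x⁴`, `L = log x`) and
`U₁ ≥ x^σ/(2N)`, the factor `18 C² B² e^{−2c₀ √log⌊√U₁⌋} + 16/√U₁` is `≤ (1 + L)^{−N'}` for `L` large, the
largeness being expressed through the two absorption inequalities `hdec1`, `hdec2`. [folklore] -/
theorem decayFactor_le {c₀ C σ Nr L Nexp Λ₁ Λ₂ : ℝ} {U₁ : ℕ} (hc₀ : 0 < c₀) (hσ : 0 < σ)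
    (hNr : 1 ≤ Nr)
    (hdec1 : ∀ L : ℝ, Λ₁ ≤ L → 2 * (18 * C ^ 2) *
      Real.exp (96 * (1 + L) ^ (1 / 4 : ℝ) - c₀ * Real.sqrt σ * Real.sqrt L) ≤ (1 + L) ^ (-Nexp))
    (hdec2 : ∀ L : ℝ, Λ₂ ≤ L → 2 * (16 * Real.sqrt (2 * Nr)) *
      Real.exp (0 * (1 + L) ^ (1 / 4 : ℝ) - σ / 2 * L) ≤ (1 + L) ^ (-Nexp))
    (hL1 : Λ₁ ≤ L) (hL2 : Λ₂ ≤ L)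
    (hL3 : (2 * Real.log (2 * Nr) + 4 * Real.log 2) / σ ≤ L) (hL4 : Real.log (8 * Nr) / σ ≤ L)
    (hVU : Real.exp (σ * L) / (2 * Nr) ≤ U₁) :
    18 * C ^ 2 * (Real.exp (48 * (L + 1) ^ (1 / 4 : ℝ))) ^ 2 *
        Real.exp (-(2 * c₀) * Real.sqrt (Real.log (Nat.sqrt U₁ : ℝ))) + 16 / Real.sqrt U₁ ≤
      (1 + L) ^ (-Nexp) := by
  set V : ℝ := Real.exp (σ * L) / (2 * Nr) with hV
  have hNr0 : 0 < Nr := by linarith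
  have hE0 : 0 < Real.exp (σ * L) := Real.exp_pos _
  have hV0 : 0 < V := by positivity
  have hσL4 : Real.log (8 * Nr) ≤ σ * L := by rwa [div_le_iff₀' hσ] at hL4
  have hσL3 : 2 * Real.log (2 * Nr) + 4 * Real.log 2 ≤ σ * L := by rwa [div_le_iff₀' hσ] at hL3
  have hV4 : 4 ≤ V := by
    rw [hV, le_div_iff₀ (by positivity)]
    have : 8 * Nr ≤ Real.exp (σ * L) := by
      have h := Real.exp_le_exp.mpr hσL4
      rwa [Real.exp_log (by positivity)] at h
    linarith
  have hsV2 : 2 ≤ Real.sqrt V := by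
    rw [Real.le_sqrt (by norm_num) hV0.le]; norm_num; linarith
  have hU₁V : V ≤ (U₁ : ℝ) := hVU
  have hU₁0 : 0 < (U₁ : ℝ) := by linarith
  -- the integer square root
  have hns : Real.sqrt V / 2 ≤ (Nat.sqrt U₁ : ℝ) := by
    have h1 : Real.sqrt (U₁ : ℝ) ≤ (Nat.sqrt U₁ : ℝ) + 1 := Real.real_sqrt_le_nat_sqrt_succ
    have h2 : Real.sqrt V ≤ Real.sqrt (U₁ : ℝ) := Real.sqrt_le_sqrt hU₁V
    linarith
  have hns0 : 0 < (Nat.sqrt U₁ : ℝ) := by linarith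
  have hlogV : Real.log V = σ * L - Real.log (2 * Nr) := by
    rw [hV, Real.log_div hE0.ne' (by positivity), Real.log_exp]
  have hlogns : σ * L / 4 ≤ Real.log (Nat.sqrt U₁ : ℝ) := by
    have h1 : Real.log (Real.sqrt V / 2) ≤ Real.log (Nat.sqrt U₁ : ℝ) :=
      Real.log_le_log (by positivity) hns
    have h2 : Real.log (Real.sqrt V / 2) = Real.log V / 2 - Real.log 2 := by
      rw [Real.log_div (by positivity) (by norm_num), Real.log_sqrt hV0.le]
    rw [h2, hlogV] at h1
    linarith
  have hlog8 : 0 ≤ Real.log (8 * Nr) := Real.log_nonneg (by linarith)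
  have hσL0 : 0 ≤ σ * L := hlog8.trans hσL4
  have hL0 : 0 ≤ L := le_of_mul_le_mul_left (by simpa using hσL0) hσ
  have hlogns0 : 0 ≤ Real.log (Nat.sqrt U₁ : ℝ) := le_trans (by positivity) hlogns
  -- first piece
  have hsq : Real.sqrt σ * Real.sqrt L / 2 ≤ Real.sqrt (Real.log (Nat.sqrt U₁ : ℝ)) := by
    rw [Real.le_sqrt (by positivity) hlogns0]
    have : (Real.sqrt σ * Real.sqrt L / 2) ^ 2 = σ * L / 4 := by
      rw [div_pow, mul_pow, Real.sq_sqrt hσ.le, Real.sq_sqrt hL0]; ring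
    rw [this]; exact hlogns
  have hpiece1 : 18 * C ^ 2 * (Real.exp (48 * (L + 1) ^ (1 / 4 : ℝ))) ^ 2 *
      Real.exp (-(2 * c₀) * Real.sqrt (Real.log (Nat.sqrt U₁ : ℝ))) ≤ (1 + L) ^ (-Nexp) / 2 := by
    have h1 : (Real.exp (48 * (L + 1) ^ (1 / 4 : ℝ))) ^ 2 = Real.exp (96 * (1 + L) ^ (1 / 4 : ℝ)) := by
      rw [← Real.exp_nat_mul, add_comm L 1]; ring_nf
    have h2 : Real.exp (-(2 * c₀) * Real.sqrt (Real.log (Nat.sqrt U₁ : ℝ))) ≤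
        Real.exp (-(c₀ * Real.sqrt σ * Real.sqrt L)) := by
      rw [Real.exp_le_exp]; nlinarith
    have h3 := hdec1 L hL1
    calc 18 * C ^ 2 * (Real.exp (48 * (L + 1) ^ (1 / 4 : ℝ))) ^ 2 *
          Real.exp (-(2 * c₀) * Real.sqrt (Real.log (Nat.sqrt U₁ : ℝ)))
        ≤ 18 * C ^ 2 * Real.exp (96 * (1 + L) ^ (1 / 4 : ℝ)) *
            Real.exp (-(c₀ * Real.sqrt σ * Real.sqrt L)) := by
          rw [h1]; exact mul_le_mul_of_nonneg_left h2 (by positivity)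
      _ = (2 * (18 * C ^ 2) *
            Real.exp (96 * (1 + L) ^ (1 / 4 : ℝ) - c₀ * Real.sqrt σ * Real.sqrt L)) / 2 := by
          rw [sub_eq_add_neg, Real.exp_add]; ring
      _ ≤ (1 + L) ^ (-Nexp) / 2 := by linarith
  -- second piece
  have hpiece2 : 16 / Real.sqrt U₁ ≤ (1 + L) ^ (-Nexp) / 2 := by
    have h1 : 16 / Real.sqrt (U₁ : ℝ) ≤ 16 / Real.sqrt V :=
      div_le_div_of_nonneg_left (by norm_num) (by positivity) (Real.sqrt_le_sqrt hU₁V)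
    have h2 : 16 / Real.sqrt V = 16 * Real.sqrt (2 * Nr) * Real.exp (-(σ / 2 * L)) := by
      rw [hV, Real.sqrt_div' _ (by positivity), Real.exp_neg, ← Real.exp_half]
      field_simp
    have h3 := hdec2 L hL2
    rw [zero_mul, zero_sub] at h3
    linarith
  linarith


/-! ### One dyadic scale -/

/-- **Square-root bookkeeping for one dyadic scale.**  If `a ≤ 4L₀²R` and
`S ≤ c₁L₀³RW + c₂L₀³RW²D + c₃L₀⁵ξ⁴W² + c₄L₀⁵ξ⁴P³` with `R ≤ ρ₁`, `R ≤ ρ₂`, then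
`√a √S ≤ (4c₁+1)L₀³ρ₁√W + (4c₂+1)L₀³ρ₁W√D + (4c₃+1)L₀⁴ξ²√ρ₁ W + (4c₄+1)L₀⁴ξ²√ρ₂ P√P`. [folklore] -/
theorem sqrt_mul_sqrt_le_four_terms {L₀ R W D ξ ρ₁ ρ₂ P a S c1 c2 c3 c4 : ℝ}
    (hL₀ : 1 ≤ L₀) (hR : 0 ≤ R) (hW : 0 ≤ W) (hD : 0 ≤ D) (hρ₁ : R ≤ ρ₁) (hρ₂ : R ≤ ρ₂)
    (hP : 0 ≤ P) (hc1 : 0 ≤ c1) (hc2 : 0 ≤ c2) (hc3 : 0 ≤ c3) (hc4 : 0 ≤ c4) (ha0 : 0 ≤ a)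
    (ha : a ≤ 4 * L₀ ^ 2 * R)
    (hS : S ≤ c1 * L₀ ^ 3 * R * W + c2 * L₀ ^ 3 * R * W ^ 2 * D + c3 * L₀ ^ 5 * ξ ^ 4 * W ^ 2 +
      c4 * L₀ ^ 5 * ξ ^ 4 * P ^ 3) :
    Real.sqrt a * Real.sqrt S ≤
      (4 * c1 + 1) * L₀ ^ 3 * ρ₁ * Real.sqrt W + (4 * c2 + 1) * L₀ ^ 3 * ρ₁ * W * Real.sqrt D +
        (4 * c3 + 1) * L₀ ^ 4 * ξ ^ 2 * Real.sqrt ρ₁ * W +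
        (4 * c4 + 1) * L₀ ^ 4 * ξ ^ 2 * Real.sqrt ρ₂ * P * Real.sqrt P := by
  have hρ₁0 : 0 ≤ ρ₁ := hR.trans hρ₁
  have hρ₂0 : 0 ≤ ρ₂ := hR.trans hρ₂
  have hL₀0 : 0 ≤ L₀ := by linarith
  have hA₁ : 0 ≤ c1 * L₀ ^ 3 * R * W := by positivity
  have hA₂ : 0 ≤ c2 * L₀ ^ 3 * R * W ^ 2 * D := by positivity
  have hA₃ : 0 ≤ c3 * L₀ ^ 5 * ξ ^ 4 * W ^ 2 := by positivity
  have hA₄ : 0 ≤ c4 * L₀ ^ 5 * ξ ^ 4 * P ^ 3 := by positivity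
  have hsq : ∀ c : ℝ, 0 ≤ c → 4 * c ≤ (4 * c + 1) ^ 2 := fun c hc => by nlinarith
  have hL56 : L₀ ^ 5 ≤ L₀ ^ 6 := pow_le_pow_right₀ hL₀ (by norm_num)
  have hL78 : L₀ ^ 7 ≤ L₀ ^ 8 := pow_le_pow_right₀ hL₀ (by norm_num)
  have hR2 : R ^ 2 ≤ ρ₁ ^ 2 := pow_le_pow_left₀ hR hρ₁ 2
  -- the four comparisons `a · Aᵢ ≤ Zᵢ²`
  have hZ1 : a * (c1 * L₀ ^ 3 * R * W) ≤ ((4 * c1 + 1) * L₀ ^ 3 * ρ₁ * Real.sqrt W) ^ 2 := by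
    calc a * (c1 * L₀ ^ 3 * R * W) ≤ (4 * L₀ ^ 2 * R) * (c1 * L₀ ^ 3 * R * W) :=
          mul_le_mul_of_nonneg_right ha hA₁
      _ = (4 * c1) * (L₀ ^ 5 * (R ^ 2 * W)) := by ring
      _ ≤ (4 * c1 + 1) ^ 2 * (L₀ ^ 6 * (ρ₁ ^ 2 * W)) :=
          mul_le_mul (hsq c1 hc1) (mul_le_mul hL56 (mul_le_mul_of_nonneg_right hR2 hW)
            (by positivity) (by positivity)) (by positivity) (by positivity)
      _ = ((4 * c1 + 1) * L₀ ^ 3 * ρ₁ * Real.sqrt W) ^ 2 := by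
          rw [mul_pow, mul_pow, mul_pow, Real.sq_sqrt hW]; ring
  have hZ2 : a * (c2 * L₀ ^ 3 * R * W ^ 2 * D) ≤
      ((4 * c2 + 1) * L₀ ^ 3 * ρ₁ * W * Real.sqrt D) ^ 2 := by
    calc a * (c2 * L₀ ^ 3 * R * W ^ 2 * D) ≤ (4 * L₀ ^ 2 * R) * (c2 * L₀ ^ 3 * R * W ^ 2 * D) :=
          mul_le_mul_of_nonneg_right ha hA₂
      _ = (4 * c2) * (L₀ ^ 5 * (R ^ 2 * (W ^ 2 * D))) := by ring
      _ ≤ (4 * c2 + 1) ^ 2 * (L₀ ^ 6 * (ρ₁ ^ 2 * (W ^ 2 * D))) :=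
          mul_le_mul (hsq c2 hc2) (mul_le_mul hL56 (mul_le_mul_of_nonneg_right hR2 (by positivity))
            (by positivity) (by positivity)) (by positivity) (by positivity)
      _ = ((4 * c2 + 1) * L₀ ^ 3 * ρ₁ * W * Real.sqrt D) ^ 2 := by
          rw [mul_pow, mul_pow, mul_pow, mul_pow, Real.sq_sqrt hD]; ring
  have hZ3 : a * (c3 * L₀ ^ 5 * ξ ^ 4 * W ^ 2) ≤
      ((4 * c3 + 1) * L₀ ^ 4 * ξ ^ 2 * Real.sqrt ρ₁ * W) ^ 2 := by
    calc a * (c3 * L₀ ^ 5 * ξ ^ 4 * W ^ 2) ≤ (4 * L₀ ^ 2 * R) * (c3 * L₀ ^ 5 * ξ ^ 4 * W ^ 2) :=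
          mul_le_mul_of_nonneg_right ha hA₃
      _ = (4 * c3) * (L₀ ^ 7 * (R * (ξ ^ 4 * W ^ 2))) := by ring
      _ ≤ (4 * c3 + 1) ^ 2 * (L₀ ^ 8 * (ρ₁ * (ξ ^ 4 * W ^ 2))) :=
          mul_le_mul (hsq c3 hc3) (mul_le_mul hL78 (mul_le_mul_of_nonneg_right hρ₁ (by positivity))
            (by positivity) (by positivity)) (by positivity) (by positivity)
      _ = ((4 * c3 + 1) * L₀ ^ 4 * ξ ^ 2 * Real.sqrt ρ₁ * W) ^ 2 := by
          rw [mul_pow, mul_pow, mul_pow, mul_pow, Real.sq_sqrt hρ₁0]; ring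
  have hZ4 : a * (c4 * L₀ ^ 5 * ξ ^ 4 * P ^ 3) ≤
      ((4 * c4 + 1) * L₀ ^ 4 * ξ ^ 2 * Real.sqrt ρ₂ * P * Real.sqrt P) ^ 2 := by
    calc a * (c4 * L₀ ^ 5 * ξ ^ 4 * P ^ 3) ≤ (4 * L₀ ^ 2 * R) * (c4 * L₀ ^ 5 * ξ ^ 4 * P ^ 3) :=
          mul_le_mul_of_nonneg_right ha hA₄
      _ = (4 * c4) * (L₀ ^ 7 * (R * (ξ ^ 4 * P ^ 3))) := by ring
      _ ≤ (4 * c4 + 1) ^ 2 * (L₀ ^ 8 * (ρ₂ * (ξ ^ 4 * P ^ 3))) :=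
          mul_le_mul (hsq c4 hc4) (mul_le_mul hL78 (mul_le_mul_of_nonneg_right hρ₂ (by positivity))
            (by positivity) (by positivity)) (by positivity) (by positivity)
      _ = ((4 * c4 + 1) * L₀ ^ 4 * ξ ^ 2 * Real.sqrt ρ₂ * P * Real.sqrt P) ^ 2 := by
          rw [mul_pow, mul_pow, mul_pow, mul_pow, mul_pow, Real.sq_sqrt hρ₂0, Real.sq_sqrt hP]; ring
  have hsa : 0 ≤ Real.sqrt a := Real.sqrt_nonneg a
  have smsl : ∀ v z : ℝ, 0 ≤ z → a * v ≤ z ^ 2 → Real.sqrt a * Real.sqrt v ≤ z := by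
    intro v z hz h
    rw [← Real.sqrt_mul ha0]
    exact (Real.sqrt_le_sqrt h).trans (Real.sqrt_sq hz).le
  calc Real.sqrt a * Real.sqrt S
      ≤ Real.sqrt a * Real.sqrt (c1 * L₀ ^ 3 * R * W + c2 * L₀ ^ 3 * R * W ^ 2 * D +
          c3 * L₀ ^ 5 * ξ ^ 4 * W ^ 2 + c4 * L₀ ^ 5 * ξ ^ 4 * P ^ 3) :=
        mul_le_mul_of_nonneg_left (Real.sqrt_le_sqrt hS) hsa
    _ ≤ Real.sqrt a * (Real.sqrt (c1 * L₀ ^ 3 * R * W) + Real.sqrt (c2 * L₀ ^ 3 * R * W ^ 2 * D) +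
          Real.sqrt (c3 * L₀ ^ 5 * ξ ^ 4 * W ^ 2) + Real.sqrt (c4 * L₀ ^ 5 * ξ ^ 4 * P ^ 3)) :=
        mul_le_mul_of_nonneg_left (sqrt_add_four_le hA₁ hA₂ hA₃ hA₄) hsa
    _ = Real.sqrt a * Real.sqrt (c1 * L₀ ^ 3 * R * W) +
          Real.sqrt a * Real.sqrt (c2 * L₀ ^ 3 * R * W ^ 2 * D) +
          Real.sqrt a * Real.sqrt (c3 * L₀ ^ 5 * ξ ^ 4 * W ^ 2) +
          Real.sqrt a * Real.sqrt (c4 * L₀ ^ 5 * ξ ^ 4 * P ^ 3) := by ring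
    _ ≤ _ := by
        gcongr ?_ + ?_ + ?_ + ?_
        · exact smsl _ _ (by positivity) hZ1
        · exact smsl _ _ (by positivity) hZ2
        · exact smsl _ _ (by positivity) hZ3
        · exact smsl _ _ (by positivity) hZ4


end DispersionBox

end Literature.NumberTheory.Sieve
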